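import Literature.NumberTheory.ModularForms.LevelOneHeckeRingLattice
import HarnessLib

/-!
# The character of `𝕋_ℤ` modulo `N` attached to a Hecke eigenvector modulo `N` in `S_k(ℤ)` (Deligne–Serre)

P. Deligne, J.-P. Serre, *Formes modulaires de poids 1*, Ann. Sci. ÉNS (4) **7** (1974), proof of **Lemme 6.11**
(p. 522), verbatim: «Soit `M` un module libre de type fini sur un anneau de valuation discrète `𝒪` … Soit `f ∈ M/𝔪M`
un vecteur propre commun (non nul) des `T ∈ 𝒯`, et soient `a_T ∈ k` les valeurs propres correspondantes. … Soit `ℋ`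
la sous-algèbre de `End(M)` engendrée par `𝒯`. … Soit `χ : ℋ → k` l'homomorphisme tel que `h.f = χ(h) f` pour tout
`h ∈ ℋ`.» — the first step of every Eisenstein-congruence argument: a vector which is an eigenvector of the generators
`T(n)` MODULO an ideal defines a CHARACTER of the whole Hecke algebra modulo that ideal. B. Datskovsky, P. Guerzhoy,
Proc. AMS **124** (1996), proof of Lemma 2.1 / Thm. 2 (p. 2286), use the same reduction for the cusp form `f ≡ G_k`
of their Theorem 1 («Applying the operator `T_n` to (1) …»).

This file carries the step out for `𝒪 = ℤ`, `M = S_k(ℤ)` (the tree's `levelOneIntegralCuspForms`, Shimura Thm. 3.52),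
`ℋ = 𝕋_ℤ = ℤ[T(n) : n ≥ 1]` (the tree's `levelOneHeckeRing`, Diamond–Shurman Def. 6.5.2) and an ARBITRARY modulus
`N` (the residue ring `ℤ/N` need not be a field): a cusp form `g ∈ S_k(ℤ)` with
`T(n)g − c(n)g ∈ N·S_k(ℤ)` for all `n ≥ 1` (`c : ℕ → ℤ`) and first coefficient `a₁(g)` prime to `N` yields a ring
homomorphism `χ_g : 𝕋_ℤ → ℤ/N` with `χ_g(T(n)) = c(n) mod N`, characterised by `Tg ≡ χ_g(T)·g (mod N·S_k(ℤ))`.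
Everything is PROVED (induction over `𝕋_ℤ = ℤ[T(n)]`, using that `S_k(ℤ)` is `𝕋_ℤ`-stable; uniqueness of the
residue from `a₁(g)` being a unit mod `N`).

## Contents (one definition with body + theorems; no named fact)

* `IsHeckeEigenvectorMod N g c` — `g ∈ S_k(ℤ)` and `T(n)g − c(n)g ∈ N·S_k(ℤ)` for all `n ≥ 1` (definition);
* `IsHeckeEigenvectorMod.exists_int_of_mem` — every `T ∈ 𝕋_ℤ` acts on `g` by an integer modulo `N·S_k(ℤ)`;
* `IsHeckeEigenvectorMod.dvd_sub_of_eq` — that integer is unique modulo `N` when `(a₁(g), N) = 1`;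
* ★`IsHeckeEigenvectorMod.character` — **`χ_g : 𝕋_ℤ →+* ZMod N`** (definition), with ★`character_spec`
  (`Tg ≡ χ_g(T) g`), ★`character_heckeTCuspₗ` (`χ_g(T(n)) = c(n)`), `character_eq_of_forall` (uniqueness: a ring
  homomorphism `𝕋_ℤ → ℤ/N` is determined by its values on the `T(n)`), `sub_mem_ker_character`
  (`T(n) − c(n) ∈ ker χ_g`: the "Eisenstein ideal" `(T(n) − c(n) : n ≥ 1)` is contained in `ker χ_g`).

## References

* [DeligneSerreASENS1974] P. Deligne, J.-P. Serre, Ann. Sci. ÉNS (4) 7 (1974), Lemme 6.11 and its proof (p. 522).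
* [DatskovskyGuerzhoy1996] B. Datskovsky, P. Guerzhoy, Proc. AMS 124 (1996), Lemma 2.1, Thm. 2 (p. 2285–2286).
* [DiamondShurman2005] F. Diamond, J. Shurman, GTM 228, Def. 6.5.2 (`𝕋_ℤ`), §6.5 (`λ_f`).
-/

noncomputable section

open scoped MatrixGroups ModularForm
open UpperHalfPlane hiding I

namespace Literature.NumberTheory.ModularForms

variable {k : ℤ}

/-! ## §0 Plumbing: first coefficients -/

section Plumbing

/-- `a₁(c • g) = c a₁(g)` and additivity, packaged: the first coefficient of `t • g + N • r`. [folklore] -/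
private theorem coeff_one_smul_add_smul (t N : ℂ) (g r : CuspForm 𝒮ℒ k) :
    (qExpansion 1 ⇑(t • g + N • r)).coeff 1 = t * (qExpansion 1 ⇑g).coeff 1 + N * (qExpansion 1 ⇑r).coeff 1 := by
  rw [CuspForm.coe_add, ModularForm.qExpansion_add one_pos one_mem_strictPeriods_SL, map_add,
    CuspForm.IsGLPos.coe_smul, ModularForm.qExpansion_smul one_pos one_mem_strictPeriods_SL,
    CuspForm.IsGLPos.coe_smul, ModularForm.qExpansion_smul one_pos one_mem_strictPeriods_SL, map_smul, map_smul,
    smul_eq_mul, smul_eq_mul]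

/-- An element of `S_k(ℤ)` has an integer first coefficient. [cite: Serre1973, Ch. VII §5.6.2] -/
private theorem exists_int_coeff_one {r : CuspForm 𝒮ℒ k} (hr : r ∈ levelOneIntegralCuspForms k) :
    ∃ m : ℤ, (m : ℂ) = (qExpansion 1 ⇑r).coeff 1 :=
  mem_levelOneIntegralCuspForms.mp hr 1

end Plumbing

/-! ## §1 Hecke eigenvectors modulo `N` in `S_k(ℤ)` -/

section EigenvectorMod

/-- **A Hecke eigenvector modulo `N`**: a cusp form `g ∈ S_k(ℤ)` with `T(n)g − c(n)g ∈ N·S_k(ℤ)` for every `n ≥ 1`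
(`c : ℕ → ℤ` the eigenvalues modulo `N`) — Deligne–Serre's «vecteur propre commun des `T ∈ 𝒯`» in `M/𝔪M`, for
`M = S_k(ℤ)`, `𝔪 = (N)`. [cite: DeligneSerreASENS1974, Lemme 6.11 (hypothesis "`f ∈ M/𝔪M` vecteur propre commun")]
[cite: DatskovskyGuerzhoy1996, Lemma 2.1 (hypothesis (1))] -/
def IsHeckeEigenvectorMod (N : ℕ) (g : CuspForm 𝒮ℒ k) (c : ℕ → ℤ) : Prop :=
  g ∈ levelOneIntegralCuspForms k ∧
    ∀ (n : ℕ) (hn : 0 < n), ∃ r ∈ levelOneIntegralCuspForms k, heckeTCusp hn g - (c n : ℂ) • g = (N : ℂ) • r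

/-- Unfolding lemma. [cite: DeligneSerreASENS1974, Lemme 6.11] -/
theorem isHeckeEigenvectorMod_iff (N : ℕ) (g : CuspForm 𝒮ℒ k) (c : ℕ → ℤ) :
    IsHeckeEigenvectorMod N g c ↔ g ∈ levelOneIntegralCuspForms k ∧
      ∀ (n : ℕ) (hn : 0 < n), ∃ r ∈ levelOneIntegralCuspForms k, heckeTCusp hn g - (c n : ℂ) • g = (N : ℂ) • r :=
  Iff.rfl

namespace IsHeckeEigenvectorMod

variable {N : ℕ} {g : CuspForm 𝒮ℒ k} {c : ℕ → ℤ}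

/-- `g ∈ S_k(ℤ)`. [cite: DeligneSerreASENS1974, Lemme 6.11] -/
theorem mem (h : IsHeckeEigenvectorMod N g c) : g ∈ levelOneIntegralCuspForms k := h.1

/-- ★ **Every `T ∈ 𝕋_ℤ` acts on `g` by an integer modulo `N·S_k(ℤ)`**: there are `t ∈ ℤ` and `r ∈ S_k(ℤ)` with
`Tg = t·g + N·r` («`h.f = χ(h) f` pour tout `h ∈ ℋ`»; induction over `ℋ = ℤ[T(n)]`, using that `S_k(ℤ)` is
`𝕋_ℤ`-stable). [cite: DeligneSerreASENS1974, Lemme 6.11 (proof, the homomorphism `χ : ℋ → k`)] -/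
theorem exists_int_of_mem (h : IsHeckeEigenvectorMod N g c) {T : Module.End ℂ (CuspForm 𝒮ℒ k)}
    (hT : T ∈ levelOneHeckeRing k) :
    ∃ t : ℤ, ∃ r ∈ levelOneIntegralCuspForms k, T g = (t : ℂ) • g + (N : ℂ) • r := by
  induction hT using Algebra.adjoin_induction with
  | mem T hT =>
    obtain ⟨n, rfl⟩ := hT
    obtain ⟨r, hr, hTr⟩ := h.2 n n.pos
    exact ⟨c n, r, hr, by rw [heckeTCuspₗ_apply, ← hTr, add_sub_cancel]⟩
  | algebraMap m =>
    refine ⟨m, 0, zero_mem _, ?_⟩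
    rw [eq_intCast, Module.End.intCast_apply, Int.cast_smul_eq_zsmul, smul_zero, add_zero]
  | add T U _ _ ihT ihU =>
    obtain ⟨t, r, hr, hTg⟩ := ihT
    obtain ⟨u, r', hr', hUg⟩ := ihU
    refine ⟨t + u, r + r', add_mem hr hr', ?_⟩
    rw [LinearMap.add_apply, hTg, hUg, Int.cast_add, add_smul, smul_add]
    abel
  | mul T U hT _ ihT ihU =>
    obtain ⟨t, r, hr, hTg⟩ := ihT
    obtain ⟨u, r', hr', hUg⟩ := ihU
    -- `TUg = T(u g + N r') = u(t g + N r) + N (T r')`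
    refine ⟨u * t, (u : ℂ) • r + T r', add_mem ?_ (apply_mem_levelOneIntegralCuspForms_of_mem hT hr'), ?_⟩
    · rw [Int.cast_smul_eq_zsmul]
      exact Submodule.smul_mem _ u hr
    · rw [Module.End.mul_apply, hUg, map_add, map_smul, map_smul, hTg, Int.cast_mul, smul_add, smul_add, smul_smul,
        smul_comm (N : ℂ) (u : ℂ) r]
      abel

/-- ★ **Uniqueness of the residue.** If `a₁(g)` is prime to `N`, the integer `t` of `exists_int_of_mem` is unique modulo
`N`: `Tg = t·g + N·r = t'·g + N·r'` with `r, r' ∈ S_k(ℤ)` forces `N ∣ t − t'` (compare first coefficients: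
`(t − t')a₁(g) ∈ Nℤ`). [cite: DeligneSerreASENS1974, Lemme 6.11 (proof: `χ` is well defined since `f ≠ 0` in `M/𝔪M`)]
[cite: DatskovskyGuerzhoy1996, Lemma 2.1 (proof, "`β₀ ≢ 0 mod P^m`")] -/
theorem dvd_sub_of_eq {a : ℤ} (ha : (a : ℂ) = (qExpansion 1 ⇑g).coeff 1) (hcop : IsCoprime a N)
    {t t' : ℤ} {r r' : CuspForm 𝒮ℒ k} (hr : r ∈ levelOneIntegralCuspForms k) (hr' : r' ∈ levelOneIntegralCuspForms k)
    (h : (t : ℂ) • g + (N : ℂ) • r = (t' : ℂ) • g + (N : ℂ) • r') : (N : ℤ) ∣ t - t' := by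
  obtain ⟨m, hm⟩ := exists_int_coeff_one hr
  obtain ⟨m', hm'⟩ := exists_int_coeff_one hr'
  have h1 := congrArg (fun F : CuspForm 𝒮ℒ k => (qExpansion 1 ⇑F).coeff 1) h
  simp only [coeff_one_smul_add_smul, ← ha, ← hm, ← hm'] at h1
  have h2 : (t - t') * a = N * (m' - m) := by
    have : ((t * a + N * m : ℤ) : ℂ) = ((t' * a + N * m' : ℤ) : ℂ) := by push_cast; exact h1
    have h3 : t * a + N * m = t' * a + N * m' := by exact_mod_cast this
    linarith
  have h4 : (N : ℤ) ∣ (t - t') * a := ⟨m' - m, h2⟩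
  exact hcop.symm.dvd_of_dvd_mul_right h4

end IsHeckeEigenvectorMod

end EigenvectorMod

/-! ## §2 The character `χ_g : 𝕋_ℤ → ℤ/N` -/

section Character

namespace IsHeckeEigenvectorMod

variable {N : ℕ} {g : CuspForm 𝒮ℒ k} {c : ℕ → ℤ}

/-- A chosen integer `t_T` with `Tg = t_T·g + N·r` for some `r ∈ S_k(ℤ)` (well defined modulo `N` by
`dvd_sub_of_eq`). [cite: DeligneSerreASENS1974, Lemme 6.11 (proof, "`h.f = χ(h) f`")] -/
def intValue (h : IsHeckeEigenvectorMod N g c) (T : levelOneHeckeRing k) : ℤ :=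
  (h.exists_int_of_mem T.2).choose

/-- Defining property of `intValue`. [cite: DeligneSerreASENS1974, Lemme 6.11 (proof)] -/
theorem intValue_spec (h : IsHeckeEigenvectorMod N g c) (T : levelOneHeckeRing k) :
    ∃ r ∈ levelOneIntegralCuspForms k,
      (T : Module.End ℂ (CuspForm 𝒮ℒ k)) g = (h.intValue T : ℂ) • g + (N : ℂ) • r :=
  (h.exists_int_of_mem T.2).choose_spec

/-- `t_1 ≡ 1`. [cite: DeligneSerreASENS1974, Lemme 6.11 (proof)] -/
theorem intValue_one (h : IsHeckeEigenvectorMod N g c) {a : ℤ} (ha : (a : ℂ) = (qExpansion 1 ⇑g).coeff 1)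
    (hcop : IsCoprime a N) : (N : ℤ) ∣ h.intValue 1 - 1 := by
  obtain ⟨r, hr, h1⟩ := h.intValue_spec 1
  rw [Subalgebra.coe_one, Module.End.one_apply] at h1
  exact dvd_sub_of_eq ha hcop hr (zero_mem _)
    (by rw [← h1, Int.cast_one, one_smul, smul_zero, add_zero])

/-- `t_0 ≡ 0`. [cite: DeligneSerreASENS1974, Lemme 6.11 (proof)] -/
theorem intValue_zero (h : IsHeckeEigenvectorMod N g c) {a : ℤ} (ha : (a : ℂ) = (qExpansion 1 ⇑g).coeff 1)
    (hcop : IsCoprime a N) : (N : ℤ) ∣ h.intValue 0 - 0 := by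
  obtain ⟨r, hr, h0⟩ := h.intValue_spec 0
  rw [Subalgebra.coe_zero, LinearMap.zero_apply] at h0
  exact dvd_sub_of_eq ha hcop hr (zero_mem _)
    (by rw [← h0, Int.cast_zero, zero_smul, smul_zero, add_zero])

/-- `t_{T+U} ≡ t_T + t_U`. [cite: DeligneSerreASENS1974, Lemme 6.11 (proof)] -/
theorem intValue_add (h : IsHeckeEigenvectorMod N g c) {a : ℤ} (ha : (a : ℂ) = (qExpansion 1 ⇑g).coeff 1)
    (hcop : IsCoprime a N) (T U : levelOneHeckeRing k) :
    (N : ℤ) ∣ h.intValue (T + U) - (h.intValue T + h.intValue U) := by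
  obtain ⟨r, hr, hT⟩ := h.intValue_spec T
  obtain ⟨r', hr', hU⟩ := h.intValue_spec U
  obtain ⟨r'', hr'', hTU⟩ := h.intValue_spec (T + U)
  have hTU' : ((T + U : levelOneHeckeRing k) : Module.End ℂ (CuspForm 𝒮ℒ k)) g =
      ((h.intValue T + h.intValue U : ℤ) : ℂ) • g + (N : ℂ) • (r + r') := by
    rw [Subalgebra.coe_add, LinearMap.add_apply, hT, hU, Int.cast_add, add_smul, smul_add]
    abel
  exact dvd_sub_of_eq ha hcop hr'' (add_mem hr hr') (hTU.symm.trans hTU')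

/-- `t_{TU} ≡ t_T t_U` (`TUg = T(t_U g + N r') = t_U(t_T g + N r) + N·T r'`, with `T r' ∈ S_k(ℤ)`).
[cite: DeligneSerreASENS1974, Lemme 6.11 (proof)] -/
theorem intValue_mul (h : IsHeckeEigenvectorMod N g c) {a : ℤ} (ha : (a : ℂ) = (qExpansion 1 ⇑g).coeff 1)
    (hcop : IsCoprime a N) (T U : levelOneHeckeRing k) :
    (N : ℤ) ∣ h.intValue (T * U) - h.intValue T * h.intValue U := by
  obtain ⟨r, hr, hT⟩ := h.intValue_spec T
  obtain ⟨r', hr', hU⟩ := h.intValue_spec U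
  obtain ⟨r'', hr'', hTU⟩ := h.intValue_spec (T * U)
  have hTU' : ((T * U : levelOneHeckeRing k) : Module.End ℂ (CuspForm 𝒮ℒ k)) g =
      ((h.intValue T * h.intValue U : ℤ) : ℂ) • g +
        (N : ℂ) • ((h.intValue U : ℂ) • r + (T : Module.End ℂ (CuspForm 𝒮ℒ k)) r') := by
    rw [Subalgebra.coe_mul, Module.End.mul_apply, hU, map_add, map_smul, map_smul, hT, Int.cast_mul, smul_add,
      smul_add, smul_smul, smul_comm (N : ℂ) (h.intValue U : ℂ) r, mul_comm (h.intValue T : ℂ)]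
    abel
  have hmem : (h.intValue U : ℂ) • r + (T : Module.End ℂ (CuspForm 𝒮ℒ k)) r' ∈ levelOneIntegralCuspForms k := by
    refine add_mem ?_ (apply_mem_levelOneIntegralCuspForms_of_mem T.2 hr')
    rw [Int.cast_smul_eq_zsmul]
    exact Submodule.smul_mem _ _ hr
  exact dvd_sub_of_eq ha hcop hr'' hmem (hTU.symm.trans hTU')

/-- ★ **The character `χ_g : 𝕋_ℤ → ℤ/N` of a Hecke eigenvector `g` modulo `N` with `(a₁(g), N) = 1`**:
`χ_g(T) = t mod N` where `Tg = t·g + N·r`, `r ∈ S_k(ℤ)` («`χ : ℋ → k` l'homomorphisme tel que `h.f = χ(h) f`»).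
[cite: DeligneSerreASENS1974, Lemme 6.11 (proof, definition of `χ`)] -/
def character (h : IsHeckeEigenvectorMod N g c) {a : ℤ} (ha : (a : ℂ) = (qExpansion 1 ⇑g).coeff 1)
    (hcop : IsCoprime a N) : levelOneHeckeRing k →+* ZMod N where
  toFun T := (h.intValue T : ZMod N)
  map_one' := by
    show (h.intValue 1 : ZMod N) = 1
    have h1 := (ZMod.intCast_eq_intCast_iff_dvd_sub (h.intValue 1) 1 N).mpr
      (by rw [dvd_sub_comm]; exact h.intValue_one ha hcop)
    rwa [Int.cast_one] at h1
  map_mul' T U := by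
    show (h.intValue (T * U) : ZMod N) = (h.intValue T : ZMod N) * (h.intValue U : ZMod N)
    rw [← Int.cast_mul, ZMod.intCast_eq_intCast_iff_dvd_sub, dvd_sub_comm]
    exact h.intValue_mul ha hcop T U
  map_zero' := by
    show (h.intValue 0 : ZMod N) = 0
    have h0 := (ZMod.intCast_eq_intCast_iff_dvd_sub (h.intValue 0) 0 N).mpr
      (by rw [dvd_sub_comm]; exact h.intValue_zero ha hcop)
    rwa [Int.cast_zero] at h0
  map_add' T U := by
    show (h.intValue (T + U) : ZMod N) = (h.intValue T : ZMod N) + (h.intValue U : ZMod N)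
    rw [← Int.cast_add, ZMod.intCast_eq_intCast_iff_dvd_sub, dvd_sub_comm]
    exact h.intValue_add ha hcop T U

/-- Unfolding lemma: `χ_g(T) = t_T mod N`. [cite: DeligneSerreASENS1974, Lemme 6.11 (proof)] -/
theorem character_apply (h : IsHeckeEigenvectorMod N g c) {a : ℤ} (ha : (a : ℂ) = (qExpansion 1 ⇑g).coeff 1)
    (hcop : IsCoprime a N) (T : levelOneHeckeRing k) : h.character ha hcop T = (h.intValue T : ZMod N) :=
  rfl

/-- ★ **Defining property of `χ_g`**: `Tg = t·g + N·r` with `r ∈ S_k(ℤ)` implies `χ_g(T) = t mod N` — i.e.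
`Tg ≡ χ_g(T)·g (mod N·S_k(ℤ))`. [cite: DeligneSerreASENS1974, Lemme 6.11 (proof, "`h.f = χ(h) f`")] -/
theorem character_eq_of_eq (h : IsHeckeEigenvectorMod N g c) {a : ℤ} (ha : (a : ℂ) = (qExpansion 1 ⇑g).coeff 1)
    (hcop : IsCoprime a N) (T : levelOneHeckeRing k) {t : ℤ} {r : CuspForm 𝒮ℒ k}
    (hr : r ∈ levelOneIntegralCuspForms k) (hT : (T : Module.End ℂ (CuspForm 𝒮ℒ k)) g = (t : ℂ) • g + (N : ℂ) • r) :
    h.character ha hcop T = (t : ZMod N) := by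
  obtain ⟨r', hr', hT'⟩ := h.intValue_spec T
  rw [character_apply, ZMod.intCast_eq_intCast_iff_dvd_sub, dvd_sub_comm]
  exact dvd_sub_of_eq ha hcop hr' hr (hT'.symm.trans hT)

/-- ★ **`Tg ≡ χ_g(T) g (mod N·S_k(ℤ))`**: for every `T ∈ 𝕋_ℤ` there are an integer `t` with `χ_g(T) = t mod N` and
`r ∈ S_k(ℤ)` with `Tg = t·g + N·r`. [cite: DeligneSerreASENS1974, Lemme 6.11 (proof)] -/
theorem character_spec (h : IsHeckeEigenvectorMod N g c) {a : ℤ} (ha : (a : ℂ) = (qExpansion 1 ⇑g).coeff 1)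
    (hcop : IsCoprime a N) (T : levelOneHeckeRing k) :
    ∃ t : ℤ, h.character ha hcop T = (t : ZMod N) ∧
      ∃ r ∈ levelOneIntegralCuspForms k, (T : Module.End ℂ (CuspForm 𝒮ℒ k)) g = (t : ℂ) • g + (N : ℂ) • r := by
  obtain ⟨r, hr, hT⟩ := h.intValue_spec T
  exact ⟨_, rfl, r, hr, hT⟩

/-- ★ **`χ_g(T(n)) = c(n) mod N`**: the character takes the prescribed eigenvalues on the Hecke operators.
[cite: DeligneSerreASENS1974, Lemme 6.11 ("`a_T ∈ k` les valeurs propres correspondantes")]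
[cite: DatskovskyGuerzhoy1996, Lemma 2.1] -/
theorem character_heckeTCuspₗ (h : IsHeckeEigenvectorMod N g c) {a : ℤ} (ha : (a : ℂ) = (qExpansion 1 ⇑g).coeff 1)
    (hcop : IsCoprime a N) {n : ℕ} (hn : 0 < n) :
    h.character ha hcop ⟨heckeTCuspₗ hn, heckeTCuspₗ_mem_levelOneHeckeRing hn⟩ = (c n : ZMod N) := by
  obtain ⟨r, hr, hTr⟩ := h.2 n hn
  exact h.character_eq_of_eq ha hcop _ hr (by rw [heckeTCuspₗ_apply, ← hTr, add_sub_cancel])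

/-- `χ_g(m) = m` for `m ∈ ℤ`. [cite: DeligneSerreASENS1974, Lemme 6.11] -/
theorem character_intCast (h : IsHeckeEigenvectorMod N g c) {a : ℤ} (ha : (a : ℂ) = (qExpansion 1 ⇑g).coeff 1)
    (hcop : IsCoprime a N) (m : ℤ) : h.character ha hcop (m : levelOneHeckeRing k) = m :=
  map_intCast _ m

/-- **`T(n) − c(n) ∈ ker χ_g`**: the ideal `(T(n) − c(n) : n ≥ 1)` of `𝕋_ℤ` — for `c(n) = σ_{k−1}(n)` the Eisenstein
ideal — is killed by `χ_g`. [cite: DeligneSerreASENS1974, Lemme 6.11 (proof, "l'idéal maximal `Ker(χ)`")] -/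
theorem sub_mem_ker_character (h : IsHeckeEigenvectorMod N g c) {a : ℤ} (ha : (a : ℂ) = (qExpansion 1 ⇑g).coeff 1)
    (hcop : IsCoprime a N) {n : ℕ} (hn : 0 < n) :
    (⟨heckeTCuspₗ hn, heckeTCuspₗ_mem_levelOneHeckeRing hn⟩ - (c n : levelOneHeckeRing k) : levelOneHeckeRing k) ∈
      RingHom.ker (h.character ha hcop) := by
  rw [RingHom.mem_ker, map_sub, h.character_heckeTCuspₗ ha hcop hn, h.character_intCast ha hcop, sub_self]

/-- The ideal generated by the `T(n) − c(n)` lies in `ker χ_g`. [cite: DeligneSerreASENS1974, Lemme 6.11 (proof)] -/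
theorem span_sub_le_ker_character (h : IsHeckeEigenvectorMod N g c) {a : ℤ} (ha : (a : ℂ) = (qExpansion 1 ⇑g).coeff 1)
    (hcop : IsCoprime a N) :
    Ideal.span (Set.range fun n : ℕ+ =>
      (⟨heckeTCuspₗ n.pos, heckeTCuspₗ_mem_levelOneHeckeRing n.pos⟩ - (c n : levelOneHeckeRing k) :
        levelOneHeckeRing k)) ≤ RingHom.ker (h.character ha hcop) := by
  rw [Ideal.span_le]
  rintro _ ⟨n, rfl⟩
  exact h.sub_mem_ker_character ha hcop n.pos

/-- **`χ_g` is surjective** (`ℤ/N` is generated by `1`). [cite: DeligneSerreASENS1974, Lemme 6.11 (proof, `χ : ℋ → k`)] -/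
theorem character_surjective (h : IsHeckeEigenvectorMod N g c) {a : ℤ} (ha : (a : ℂ) = (qExpansion 1 ⇑g).coeff 1)
    (hcop : IsCoprime a N) : Function.Surjective (h.character ha hcop) :=
  ZMod.ringHom_surjective _

/-- **Uniqueness**: a ring homomorphism `𝕋_ℤ → ℤ/N` is determined by its values on the `T(n)`, `n ≥ 1` (they
generate `𝕋_ℤ` as a ring); in particular `χ_g` is THE homomorphism with `T(n) ↦ c(n)`.
[cite: DiamondShurman2005, Def. 6.5.2 (`𝕋_ℤ = ℤ[T_n]`)] [cite: DeligneSerreASENS1974, Lemme 6.11] -/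
theorem ringHom_ext_heckeTCuspₗ {S : Type*} [Ring S] {φ ψ : levelOneHeckeRing k →+* S}
    (hφψ : ∀ (n : ℕ) (hn : 0 < n), φ ⟨heckeTCuspₗ hn, heckeTCuspₗ_mem_levelOneHeckeRing hn⟩ =
      ψ ⟨heckeTCuspₗ hn, heckeTCuspₗ_mem_levelOneHeckeRing hn⟩) : φ = ψ := by
  refine RingHom.ext fun T => ?_
  obtain ⟨T, hT⟩ := T
  induction hT using Algebra.adjoin_induction with
  | mem T hT =>
    obtain ⟨n, rfl⟩ := hT
    exact hφψ n n.pos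
  | algebraMap m =>
    have : (⟨algebraMap ℤ (Module.End ℂ (CuspForm 𝒮ℒ k)) m, Subalgebra.algebraMap_mem _ m⟩ : levelOneHeckeRing k) =
        (m : levelOneHeckeRing k) := Subtype.ext (by
      change algebraMap ℤ (Module.End ℂ (CuspForm 𝒮ℒ k)) m = ((m : levelOneHeckeRing k) : Module.End ℂ (CuspForm 𝒮ℒ k))
      rw [SubringClass.coe_intCast, eq_intCast])
    rw [this, map_intCast, map_intCast]
  | add T U hT hU ihT ihU =>
    have : (⟨T + U, add_mem hT hU⟩ : levelOneHeckeRing k) = ⟨T, hT⟩ + ⟨U, hU⟩ := rfl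
    rw [this, map_add, map_add, ihT, ihU]
  | mul T U hT hU ihT ihU =>
    have : (⟨T * U, mul_mem hT hU⟩ : levelOneHeckeRing k) = ⟨T, hT⟩ * ⟨U, hU⟩ := rfl
    rw [this, map_mul, map_mul, ihT, ihU]

/-- `χ_g` is the unique ring homomorphism `𝕋_ℤ → ℤ/N` with `T(n) ↦ c(n) mod N`.
[cite: DeligneSerreASENS1974, Lemme 6.11] -/
theorem character_eq_of_forall (h : IsHeckeEigenvectorMod N g c) {a : ℤ} (ha : (a : ℂ) = (qExpansion 1 ⇑g).coeff 1)
    (hcop : IsCoprime a N) {ψ : levelOneHeckeRing k →+* ZMod N}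
    (hψ : ∀ (n : ℕ) (hn : 0 < n), ψ ⟨heckeTCuspₗ hn, heckeTCuspₗ_mem_levelOneHeckeRing hn⟩ = (c n : ZMod N)) :
    ψ = h.character ha hcop :=
  ringHom_ext_heckeTCuspₗ fun n hn => by rw [hψ n hn, h.character_heckeTCuspₗ ha hcop hn]

end IsHeckeEigenvectorMod

end Character

end Literature.NumberTheory.ModularForms
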